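import Literature.Analysis.FluidPDE.TaoH1FourierDecomposition
import Literature.Analysis.FluidPDE.FourierL2Convolution
import HarnessLib

/-!
# Plancherel for smooth `H^∞` vector fields: discharge of `sobolev_fourierDatum_of_smooth`

This file proves the named fact `Literature.Analysis.FluidPDE.sobolev_fourierDatum_of_smooth` of
`TaoH1FourierDecomposition` (`sobolev_fourierDatum_of_smooth_holds`): every smooth divergence-free
`u₀ : ℝ³ → ℝ³` with `∫ ‖Dⁿu₀‖² < ∞` for all `n` is the synthesis `synthVel a = Re 𝓕 a` of a Fourier
datum `a` of Sobolev class (`IsSobolevFourierDatum a`: measurable, all weighted square moments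
finite, `∑ₗ ξₗ aₗ(ξ) = 0` and `a(−ξ) = conj a(ξ)` at every frequency), with
`∫ (1 + 4π²‖ξ‖²) ∑ₗ |aₗ|² = ‖u₀‖²_{L²} + ‖∇u₀‖²_{L²}`. The result is proved in every dimension
(`FourierNS.exists_isSobolevFourierDatum` on `EuclideanSpace ℝ ι`).

## The argument

(Stein–Weiss 1971, Ch. I: Thm. 2.3 = Plancherel, Thm. 1.8 / (1.9)(ii) = transform of a derivative.)

Write `gₗ = u₀ₗ` for the components and let `Fₗ` be (a representative of) the `L²` inverse Fourier
transform `𝓕⁻¹gₗ` (Mathlib's unitary `L²` transform `MeasureTheory.Lp.fourierTransformₗᵢ`, i.e.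
Stein–Weiss Thm. 2.3).

* **Transform of a derivative on `L²`** (`fourierInv_toLp_fderiv_ae_eq`): for `f` differentiable
  with `f, ∂ᵥf ∈ L²`, `𝓕⁻¹(∂ᵥf) = −2πi⟪ξ, v⟫ 𝓕⁻¹f` a.e. Stein–Weiss prove Thm. 1.8 for `L¹`
  functions by difference quotients; here the `L²` statement is obtained through Mathlib's tempered
  distributions:
  `T_{∂ᵥf} = ∂ᵥT_f` by integration by parts against Schwartz functions
  (`integral_mul_fderiv_eq_neg_fderiv_mul_of_integrable`), then
  `TemperedDistribution.fourierInv_lineDerivOp_eq` and `Lp.fourierInv_toTemperedDistribution_eq`,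
  and finally uniqueness of locally integrable densities (`ae_eq_of_integral_contDiff_smul_eq`).
  Iterating along words gives `𝓕⁻¹(∂^α g) = dsym α · 𝓕⁻¹g` ((1.9)(ii); `fourierInv_ipderiv_ae_eq`).
* **Plancherel** (`lintegral_enorm_sq_fourierInv`, `lintegral_weight_mul_enorm_sq_fourierInv_eq`):
  `∫ (2π)^{2m}‖ξ‖^{2m} |Fₗ|² = ∑_{|α| = m} ∫ |∂^α gₗ|² ≤ ∞`, whence all weighted moments
  `∫ (1 + ‖ξ‖)^{2k} |Fₗ|²` are finite, and (weighted Cauchy–Schwarz against `(1 + ‖ξ‖)^{-2k} ∈ L¹`,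
  `2k > dim`) `Fₗ ∈ L¹`.
* **Pointwise inversion** (`fourierIntegral_fourierInv_eq`, Stein–Weiss Thm. 2.4 for
  `f̂ ∈ L¹ ∩ L²`): the Fourier *integral* of `Fₗ` agrees a.e. with the `L²` transform
  (`FourierNS.fourier_toLp_ae_eq` of `NSFourierPlancherel`), hence equals `gₗ` everywhere by
  continuity; so `Re 𝓕 Fₗ = u₀ₗ`.
* **Symmetries a.e.**: `Fₗ(−ξ) = conj Fₗ(ξ)` a.e. (both sides are `L¹ ∩ L²` functions with Fourier
  integral `gₗ`; injectivity of the `L²` transform), and `∑ₗ ξₗ Fₗ(ξ) = 0` a.e. (the word rule for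
  `∂ₗ` and `∑ₗ ∂ₗu₀ₗ = 0`).
* **Everywhere**: the datum is `a = 𝟙_S · F` for the full-measure set
  `S = S₁ ∩ (−S₁)`, `S₁ = {both symmetries hold at ξ}`, which is symmetric under `ξ ↦ −ξ`; this
  modification on a null set changes neither the moments nor the Fourier integrals.
* **`H¹` identity**: Plancherel at orders `0` and `1`, with `‖u₀(x)‖² = ∑ₗ u₀ₗ(x)²` and
  `|∇u₀(x)|²_F = ∑ₗ ∑ⱼ (∂ⱼu₀ₗ(x))²` (`levelSq_one_eq_frobeniusNormSq`).

## References

* E. M. Stein, G. Weiss, *Introduction to Fourier Analysis on Euclidean Spaces*, Princeton UP 1971,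
  Ch. I: Thm. 1.8 and (1.9)(ii) (transform of derivatives; held copy p. 9), Thm. 2.1, Thm. 2.3,
  Thm. 2.4 (Plancherel, unitarity, inversion; held copy pp. 19–20). [SteinWeiss1971]
-/

noncomputable section

open MeasureTheory Set Function Filter Real Complex FourierTransform SchwartzMap
open scoped ENNReal NNReal ContDiff ComplexConjugate FourierTransform RealInnerProductSpace
open scoped LineDeriv
open _root_.Topology

namespace Literature.Analysis.FluidPDE

namespace FourierNS

/-! ### Two elementary real inequalities and two `L²` conveniences -/

/-- `(1 + t)^{2k} ≤ 4^k (1 + t^{2k})` for `t ≥ 0`. [folklore] -/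
theorem one_add_pow_two_mul_le {t : ℝ} (ht : 0 ≤ t) (k : ℕ) :
    (1 + t) ^ (2 * k) ≤ 4 ^ k * (1 + t ^ (2 * k)) := by
  rcases le_total t 1 with h | h
  · calc (1 + t) ^ (2 * k) ≤ (1 + 1) ^ (2 * k) := by gcongr
      _ = 4 ^ k := by rw [pow_mul]; norm_num
      _ ≤ 4 ^ k * (1 + t ^ (2 * k)) :=
          le_mul_of_one_le_right (by positivity) (le_add_of_nonneg_right (by positivity))
  · calc (1 + t) ^ (2 * k) ≤ (t + t) ^ (2 * k) := by gcongr
      _ = 4 ^ k * t ^ (2 * k) := by rw [← two_mul, mul_pow, pow_mul]; norm_num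
      _ ≤ 4 ^ k * (1 + t ^ (2 * k)) := by gcongr; exact le_add_of_nonneg_left zero_le_one

/-- `t ≤ w⁻¹ + w t²` for `w > 0`. [folklore] -/
theorem le_inv_add_mul_sq {w t : ℝ} (hw : 0 < w) (ht : 0 ≤ t) : t ≤ w⁻¹ + w * t ^ 2 := by
  rw [inv_eq_one_div, div_add' _ _ _ hw.ne', le_div_iff₀ hw]
  nlinarith [sq_nonneg (w * t - 1), mul_nonneg hw.le ht]

/-- `f ∈ L²` from measurability and `∫ |f|² < ∞`. [folklore] -/
theorem memLp_two_of_lintegral_sq_lt_top {α : Type*} [MeasurableSpace α] {μ : Measure α}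
    {f : α → ℂ} (hf : AEStronglyMeasurable f μ) (h : ∫⁻ x, ‖f x‖ₑ ^ 2 ∂μ < ⊤) : MemLp f 2 μ := by
  refine ⟨hf, ?_⟩
  rw [lintegral_enorm_sq_eq_eLpNorm_sq] at h
  by_contra hcon
  rw [not_lt, top_le_iff] at hcon
  rw [hcon] at h
  simp at h

/-- `‖(r : ℂ)‖ₑ² = r²` in `ℝ≥0∞`. [folklore] -/
theorem enorm_ofReal_sq (r : ℝ) : ‖((r : ℝ) : ℂ)‖ₑ ^ 2 = ENNReal.ofReal (r ^ 2) := by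
  rw [← ofReal_norm, Complex.norm_real, Real.norm_eq_abs, ← ENNReal.ofReal_pow (abs_nonneg _),
    sq_abs]

section General

variable {V : Type*} [NormedAddCommGroup V] [InnerProductSpace ℝ V] [FiniteDimensional ℝ V]
  [MeasurableSpace V] [BorelSpace V]

/-! ### The transform of a derivative on `L²` (Stein–Weiss, Ch. I, Thm. 1.8) -/

/-- The product of two `L²` functions is integrable (Hölder with exponents `2, 2`). [folklore] -/
theorem integrable_mul_of_memLp_two {f g : V → ℂ} (hf : MemLp f 2 volume) (hg : MemLp g 2 volume) :
    Integrable (fun x => f x * g x) := by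
  have h : MemLp (fun x => f x * g x) 1 volume := MemLp.mul' (p := 2) (q := 2) (r := 1) hg hf
  exact memLp_one_iff_integrable.1 h

/-- **The distributional derivative of an `L²` function with `L²` derivative** (integration by
parts against Schwartz test functions): for `f` differentiable with `f, ∂_v f ∈ L²`,
`T_{∂_v f} = ∂_v T_f` in `𝓢'`. [folklore] -/
theorem toTemperedDistribution_toLp_fderiv_eq {f : V → ℂ} (hf : Differentiable ℝ f)
    (hf2 : MemLp f 2 volume) (v : V) (hdf2 : MemLp (fun x => fderiv ℝ f x v) 2 volume) :
    (Lp.toTemperedDistribution (hdf2.toLp _) : 𝓢'(V, ℂ)) =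
      ∂_{v} (Lp.toTemperedDistribution (hf2.toLp f) : 𝓢'(V, ℂ)) := by
  ext φ
  rw [Lp.toTemperedDistribution_apply, TemperedDistribution.lineDerivOp_apply_apply,
    Lp.toTemperedDistribution_apply]
  have h1 : ∫ x, φ x • ((hdf2.toLp _ : Lp ℂ 2 (volume : Measure V)) : V → ℂ) x =
      ∫ x, φ x * fderiv ℝ f x v := by
    refine integral_congr_ae ?_
    filter_upwards [hdf2.coeFn_toLp] with x hx
    rw [hx, smul_eq_mul]
  have h2 : ∫ x, (-∂_{v} φ : 𝓢(V, ℂ)) x • ((hf2.toLp f : Lp ℂ 2 (volume : Measure V)) : V → ℂ) x =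
      -∫ x, fderiv ℝ (φ : V → ℂ) x v * f x := by
    rw [← integral_neg]
    refine integral_congr_ae ?_
    filter_upwards [hf2.coeFn_toLp] with x hx
    rw [hx, neg_apply, SchwartzMap.lineDerivOp_apply_eq_fderiv, smul_eq_mul, neg_mul]
  rw [h1, h2]
  have hφ2 : MemLp (φ : V → ℂ) 2 volume := φ.memLp 2 volume
  have hdφ2 : MemLp (fun x => fderiv ℝ (φ : V → ℂ) x v) 2 volume := by
    have := (∂_{v} φ : 𝓢(V, ℂ)).memLp 2 volume
    refine this.ae_eq (Eventually.of_forall fun x => ?_)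
    exact SchwartzMap.lineDerivOp_apply_eq_fderiv v φ x
  exact integral_mul_fderiv_eq_neg_fderiv_mul_of_integrable
    (integrable_mul_of_memLp_two hdφ2 hf2) (integrable_mul_of_memLp_two hφ2 hdf2)
    (integrable_mul_of_memLp_two hφ2 hf2) (fun x _ => φ.differentiableAt)
    (fun x _ => hf x)

/-- **Stein–Weiss, Ch. I, Thm. 1.8 on `L²` (the transform of a derivative).** For `f`
differentiable with `f, ∂_v f ∈ L²(ℝ^ι)`, the `L²` inverse Fourier transforms satisfy
`𝓕⁻¹(∂_v f)(ξ) = -2πi ⟪ξ, v⟫ 𝓕⁻¹ f (ξ)` for a.e. `ξ` (representatives of the `L²` classes).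
Proof: `T_{∂_v f} = ∂_v T_f` (integration by parts), Mathlib's
`TemperedDistribution.fourierInv_lineDerivOp_eq`, and uniqueness of locally integrable densities.
[cite: SteinWeiss1971, Ch. I Thm. 1.8] -/
theorem fourierInv_toLp_fderiv_ae_eq {f : V → ℂ} (hf : Differentiable ℝ f)
    (hf2 : MemLp f 2 volume) (v : V) (hdf2 : MemLp (fun x => fderiv ℝ f x v) 2 volume) :
    ((𝓕⁻ (hdf2.toLp _) : Lp ℂ 2 (volume : Measure V)) : V → ℂ) =ᵐ[volume]
      fun ξ => (-(2 * π * I) * ((⟪ξ, v⟫ : ℝ) : ℂ)) *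
        ((𝓕⁻ (hf2.toLp f) : Lp ℂ 2 (volume : Measure V)) : V → ℂ) ξ := by
  set G : Lp ℂ 2 (volume : Measure V) := 𝓕⁻ (hdf2.toLp _) with hG
  set F : Lp ℂ 2 (volume : Measure V) := 𝓕⁻ (hf2.toLp f) with hF
  have hsymb : (fun x : V => (((⟪x, v⟫ : ℝ) : ℂ))).HasTemperateGrowth := by fun_prop
  -- the identity of tempered distributions
  have hdist : (Lp.toTemperedDistribution G : 𝓢'(V, ℂ)) =
      -(2 * π * Complex.I) • TemperedDistribution.smulLeftCLM ℂ (fun x : V => (((⟪x, v⟫ : ℝ) : ℂ)))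
        (Lp.toTemperedDistribution F : 𝓢'(V, ℂ)) := by
    rw [hG, hF, ← Lp.fourierInv_toTemperedDistribution_eq,
      ← Lp.fourierInv_toTemperedDistribution_eq,
      toTemperedDistribution_toLp_fderiv_eq hf hf2 v hdf2,
      TemperedDistribution.fourierInv_lineDerivOp_eq]
  -- tested against Schwartz functions
  have key : ∀ φ : 𝓢(V, ℂ), ∫ x, φ x • (G : V → ℂ) x =
      ∫ x, φ x • ((-(2 * π * I) * ((⟪x, v⟫ : ℝ) : ℂ)) * (F : V → ℂ) x) := by
    intro φ
    have h1 : ∫ x, φ x • (G : V → ℂ) x = (Lp.toTemperedDistribution G : 𝓢'(V, ℂ)) φ :=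
      (Lp.toTemperedDistribution_apply G φ).symm
    rw [h1, hdist, FunLike.coe_smul, Pi.smul_apply, TemperedDistribution.smulLeftCLM_apply_apply,
      Lp.toTemperedDistribution_apply, ← integral_smul]
    refine integral_congr_ae (Eventually.of_forall fun x => ?_)
    simp only [SchwartzMap.smulLeftCLM_apply_apply hsymb, smul_eq_mul]
    ring
  refine ae_eq_of_integral_contDiff_smul_eq ((Lp.memLp G).locallyIntegrable (by norm_num)) ?_
    fun φ hφ hsupp => ?_
  · have hFl : LocallyIntegrable (F : V → ℂ) volume := (Lp.memLp F).locallyIntegrable (by norm_num)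
    have hc : Continuous fun x : V => (-(2 * π * I) * ((⟪x, v⟫ : ℝ) : ℂ)) := by fun_prop
    exact (locallyIntegrableOn_univ.1
      ((hFl.locallyIntegrableOn univ).continuousOn_mul hc.continuousOn isOpen_univ.isLocallyClosed))
  have hφc : HasCompactSupport fun x => ((φ x : ℝ) : ℂ) := hsupp.comp_left Complex.ofReal_zero
  have hφs : ContDiff ℝ ∞ fun x => ((φ x : ℝ) : ℂ) := ofRealCLM.contDiff.comp hφ
  have h := key (hφc.toSchwartzMap hφs)
  have hcoe : ∀ x, (hφc.toSchwartzMap hφs) x = ((φ x : ℝ) : ℂ) := fun x => rfl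
  simp only [hcoe] at h
  simpa only [Complex.real_smul, smul_eq_mul] using h

/-- An `Lp` element a.e. equal to `f` is `toLp f`. [folklore] -/
theorem toLp_eq_of_coeFn_ae_eq {f : V → ℂ} (hf : MemLp f 2 volume) {X : Lp ℂ 2 (volume : Measure V)}
    (hX : (X : V → ℂ) =ᵐ[volume] f) : hf.toLp f = X := by
  rw [← Lp.toLp_coeFn X (Lp.memLp X)]
  exact (MemLp.toLp_eq_toLp_iff hf (Lp.memLp X)).2 hX.symm

/-- The derivative rule, for arbitrary `L²` representatives: if `Xf = f` and `Xdf = ∂_v f` a.e.,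
then `𝓕⁻¹ Xdf = -2πi⟪ξ, v⟫ 𝓕⁻¹ Xf` a.e. [cite: SteinWeiss1971, Ch. I Thm. 1.8] -/
theorem fourierInv_fderiv_ae_eq {f : V → ℂ} (hf : Differentiable ℝ f)
    (hf2 : MemLp f 2 volume) (v : V) (hdf2 : MemLp (fun x => fderiv ℝ f x v) 2 volume)
    {Xf Xdf : Lp ℂ 2 (volume : Measure V)} (hXf : (Xf : V → ℂ) =ᵐ[volume] f)
    (hXdf : (Xdf : V → ℂ) =ᵐ[volume] fun x => fderiv ℝ f x v) :
    ((𝓕⁻ Xdf : Lp ℂ 2 (volume : Measure V)) : V → ℂ) =ᵐ[volume]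
      fun ξ => (-(2 * π * I) * ((⟪ξ, v⟫ : ℝ) : ℂ)) *
        ((𝓕⁻ Xf : Lp ℂ 2 (volume : Measure V)) : V → ℂ) ξ := by
  rw [← toLp_eq_of_coeFn_ae_eq hf2 hXf, ← toLp_eq_of_coeFn_ae_eq hdf2 hXdf]
  exact fourierInv_toLp_fderiv_ae_eq hf hf2 v hdf2

/-! ### Plancherel for representatives, uniqueness, conjugation -/

/-- **Plancherel (Stein–Weiss, Ch. I, Thm. 2.3) for representatives**: `∫ |𝓕⁻¹ X|² = ∫ |X|²`.
[cite: SteinWeiss1971, Ch. I Thm. 2.3] -/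
theorem lintegral_enorm_sq_fourierInv (X : Lp ℂ 2 (volume : Measure V)) :
    ∫⁻ ξ, ‖((𝓕⁻ X : Lp ℂ 2 (volume : Measure V)) : V → ℂ) ξ‖ₑ ^ 2 = ∫⁻ x, ‖(X : V → ℂ) x‖ₑ ^ 2 := by
  rw [lintegral_enorm_sq_eq_eLpNorm_sq, lintegral_enorm_sq_eq_eLpNorm_sq]
  congr 1
  have h : ‖(𝓕⁻ X : Lp ℂ 2 (volume : Measure V))‖ = ‖X‖ := by
    rw [← Lp.norm_fourier_eq (𝓕⁻ X : Lp ℂ 2 (volume : Measure V)), fourier_fourierInv_eq]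
  rw [Lp.norm_def, Lp.norm_def,
    ENNReal.toReal_eq_toReal_iff' (Lp.eLpNorm_ne_top _) (Lp.eLpNorm_ne_top _)] at h
  exact h

/-- Plancherel for `toLp`: `∫ |𝓕⁻¹ f|² = ∫ |f|²`. [cite: SteinWeiss1971, Ch. I Thm. 2.3] -/
theorem lintegral_enorm_sq_fourierInv_of_ae_eq {f : V → ℂ} {X : Lp ℂ 2 (volume : Measure V)}
    (hX : (X : V → ℂ) =ᵐ[volume] f) :
    ∫⁻ ξ, ‖((𝓕⁻ X : Lp ℂ 2 (volume : Measure V)) : V → ℂ) ξ‖ₑ ^ 2 = ∫⁻ x, ‖f x‖ₑ ^ 2 := by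
  rw [lintegral_enorm_sq_fourierInv]
  exact lintegral_congr_ae (by filter_upwards [hX] with x hx; rw [hx])

/-- **Uniqueness**: two `L¹ ∩ L²` functions with the same Fourier integral agree a.e. (injectivity
of the unitary `L²` transform, Stein–Weiss Ch. I Thm. 2.3).
[cite: SteinWeiss1971, Ch. I Thm. 2.3] -/
theorem ae_eq_of_fourierIntegral_eq {F G : V → ℂ} (hF1 : Integrable F) (hF2 : MemLp F 2 volume)
    (hG1 : Integrable G) (hG2 : MemLp G 2 volume) (h : 𝓕 F = 𝓕 G) : F =ᵐ[volume] G := by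
  have hF := fourier_toLp_ae_eq hF1 hF2
  have hG := fourier_toLp_ae_eq hG1 hG2
  rw [h] at hF
  have heq : (𝓕 (hF2.toLp F) : Lp ℂ 2 (volume : Measure V)) = 𝓕 (hG2.toLp G) :=
    Lp.ext (hF.trans hG.symm)
  have heq2 : hF2.toLp F = hG2.toLp G := by
    have := congrArg (fun Y : Lp ℂ 2 (volume : Measure V) =>
      (𝓕⁻ Y : Lp ℂ 2 (volume : Measure V))) heq
    simpa only [fourierInv_fourier_eq] using this
  exact (MemLp.toLp_eq_toLp_iff hF2 hG2).1 heq2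

/-- `𝓕 (conj F(−·)) = conj 𝓕 F` pointwise. [folklore] -/
theorem fourierIntegral_conj_neg (F : V → ℂ) (x : V) :
    𝓕 (fun ξ => conj (F (-ξ))) x = conj (𝓕 F x) := by
  rw [Real.fourier_eq, Real.fourier_eq, ← integral_conj, ← integral_neg_eq_self _ volume]
  refine integral_congr_ae (Eventually.of_forall fun ξ => ?_)
  simp only [Circle.smul_def, smul_eq_mul, map_mul, inner_neg_left, neg_neg,
    Circle.starRingEnd_addChar]

omit [FiniteDimensional ℝ V] [MeasurableSpace V] [BorelSpace V] in
/-- The derivative of the complexification: `D(↑g)(x) v = ↑(Dg(x) v)`. [folklore] -/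
theorem ofReal_comp_fderiv_apply {g : V → ℝ} (hg : Differentiable ℝ g) (x v : V) :
    fderiv ℝ (fun y => ((g y : ℝ) : ℂ)) x v = ((fderiv ℝ g x v : ℝ) : ℂ) := by
  have h := (Complex.ofRealCLM.hasFDerivAt.comp x (hg x).hasFDerivAt).fderiv
  rw [show (fun y => ((g y : ℝ) : ℂ)) = (Complex.ofRealCLM : ℝ → ℂ) ∘ g from rfl, h]
  rfl

omit [FiniteDimensional ℝ V] [MeasurableSpace V] [BorelSpace V] in
/-- The complexification of a differentiable real function is differentiable. [folklore] -/
theorem differentiable_ofReal_comp {g : V → ℝ} (hg : Differentiable ℝ g) :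
    Differentiable ℝ fun y => ((g y : ℝ) : ℂ) :=
  Complex.ofRealCLM.differentiable.comp hg

end General

/-! ### Word derivatives on `ℝ^ι` (Stein–Weiss (1.9)(ii)) and weighted square moments -/

section Euclidean

variable {ι : Type*} [Fintype ι] [DecidableEq ι]

/-- **Stein–Weiss (1.9)(ii) on `L²`, word form**: for a smooth real `g` all of whose word
derivatives are square integrable, `𝓕⁻¹(∂^α g) = dsym α · 𝓕⁻¹ g` a.e., where
`dsym α ξ = ∏ⱼ (−2πi ξ_{α j})`. [cite: SteinWeiss1971, Ch. I Thm. 1.8] -/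
theorem fourierInv_ipderiv_ae_eq {g : EuclideanSpace ℝ ι → ℝ} (hg : ContDiff ℝ ∞ g)
    (hL2 : ∀ {m : ℕ} (β : Fin m → ι), MemLp (fun x => ((ipderiv β g x : ℝ) : ℂ)) 2 volume)
    {X₀ : Lp ℂ 2 (volume : Measure (EuclideanSpace ℝ ι))}
    (hX₀ : (X₀ : EuclideanSpace ℝ ι → ℂ) =ᵐ[volume] fun x => ((g x : ℝ) : ℂ)) :
    ∀ {m : ℕ} (α : Fin m → ι) {Xα : Lp ℂ 2 (volume : Measure (EuclideanSpace ℝ ι))},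
      ((Xα : EuclideanSpace ℝ ι → ℂ) =ᵐ[volume] fun x => ((ipderiv α g x : ℝ) : ℂ)) →
      ((𝓕⁻ Xα : Lp ℂ 2 volume) : EuclideanSpace ℝ ι → ℂ) =ᵐ[volume]
        fun ξ => dsym α ξ * ((𝓕⁻ X₀ : Lp ℂ 2 volume) : EuclideanSpace ℝ ι → ℂ) ξ
  | 0, α, Xα, hXα => by
      have h : Xα = X₀ :=
        (toLp_eq_of_coeFn_ae_eq (hL2 α) hXα).symm.trans (toLp_eq_of_coeFn_ae_eq (hL2 α) hX₀)
      subst h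
      exact Eventually.of_forall fun ξ => by simp only [dsym_zero, one_mul]
  | m + 1, α, Xα, hXα => by
      -- one letter: `∂^α g = ∂_{α 0} (∂^{tail α} g)`
      set f : EuclideanSpace ℝ ι → ℂ := fun x => ((ipderiv (Fin.tail α) g x : ℝ) : ℂ) with hf_def
      have hfd : Differentiable ℝ f :=
        differentiable_ofReal_comp ((contDiff_ipderiv hg (Fin.tail α)).differentiable (by simp))
      have hfun : (fun x => fderiv ℝ f x (stdVec (α 0))) = fun x => ((ipderiv α g x : ℝ) : ℂ) := by
        funext x
        rw [hf_def, ofReal_comp_fderiv_apply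
          ((contDiff_ipderiv hg (Fin.tail α)).differentiable (by simp)), ipderiv_succ, pderiv_apply]
      have hdf2 : MemLp (fun x => fderiv ℝ f x (stdVec (α 0))) 2 volume := hfun ▸ hL2 α
      have hXα' : (Xα : EuclideanSpace ℝ ι → ℂ) =ᵐ[volume] fun x => fderiv ℝ f x (stdVec (α 0)) :=
        hfun ▸ hXα
      have h1 := fourierInv_fderiv_ae_eq hfd (hL2 (Fin.tail α)) (stdVec (α 0)) hdf2
        (MemLp.coeFn_toLp (hL2 (Fin.tail α))) hXα'
      have h2 :=
        fourierInv_ipderiv_ae_eq hg hL2 hX₀ (Fin.tail α) (MemLp.coeFn_toLp (hL2 (Fin.tail α)))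
      filter_upwards [h1, h2] with ξ h1ξ h2ξ
      rw [h1ξ, h2ξ, dsym_succ, inner_stdVec_right]
      ring

omit [DecidableEq ι] in
/-- `(2π)^{2m} ‖ξ‖^{2m} |z|² = ∑_α |dsym α ξ · z|²` in `ℝ≥0∞`. [folklore] -/
theorem ofReal_weight_mul_enorm_sq (m : ℕ) (ξ : EuclideanSpace ℝ ι) (z : ℂ) :
    ENNReal.ofReal ((2 * π) ^ (2 * m) * ‖ξ‖ ^ (2 * m)) * ‖z‖ₑ ^ 2 =
      ∑ α : Fin m → ι, ‖dsym α ξ * z‖ₑ ^ 2 := by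
  have h : ∀ w : ℂ, ‖w‖ₑ ^ 2 = ENNReal.ofReal (‖w‖ ^ 2) := fun w => by
    rw [← ofReal_norm, ENNReal.ofReal_pow (norm_nonneg _)]
  simp_rw [h, norm_mul, mul_pow]
  rw [← ENNReal.ofReal_sum_of_nonneg (fun α _ => by positivity), ← Finset.sum_mul, sum_norm_dsym_sq,
    ← ENNReal.ofReal_mul (by positivity)]
  congr 1
  ring

/-- **Plancherel for the word derivatives**: `∫ (2π)^{2m}‖ξ‖^{2m} |𝓕⁻¹g|² dξ = ∑_α ∫ |∂^α g|²`.
[cite: SteinWeiss1971, Ch. I Thm. 2.3 + Thm. 1.8] -/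
theorem lintegral_weight_mul_enorm_sq_fourierInv_eq {g : EuclideanSpace ℝ ι → ℝ}
    (hg : ContDiff ℝ ∞ g)
    (hL2 : ∀ {m : ℕ} (β : Fin m → ι), MemLp (fun x => ((ipderiv β g x : ℝ) : ℂ)) 2 volume)
    {X₀ : Lp ℂ 2 (volume : Measure (EuclideanSpace ℝ ι))}
    (hX₀ : (X₀ : EuclideanSpace ℝ ι → ℂ) =ᵐ[volume] fun x => ((g x : ℝ) : ℂ))
    (m : ℕ) :
    ∫⁻ ξ, ENNReal.ofReal ((2 * π) ^ (2 * m) * ‖ξ‖ ^ (2 * m)) *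
        ‖((𝓕⁻ X₀ : Lp ℂ 2 volume) : EuclideanSpace ℝ ι → ℂ) ξ‖ₑ ^ 2 =
      ∑ α : Fin m → ι, ∫⁻ x, ‖((ipderiv α g x : ℝ) : ℂ)‖ₑ ^ 2 := by
  simp_rw [ofReal_weight_mul_enorm_sq]
  rw [lintegral_finsetSum' _ (fun α _ => ?_)]
  · refine Finset.sum_congr rfl fun α _ => ?_
    rw [← lintegral_enorm_sq_fourierInv_of_ae_eq (MemLp.coeFn_toLp (hL2 α))]
    refine lintegral_congr_ae ?_
    filter_upwards [fourierInv_ipderiv_ae_eq hg hL2 hX₀ α (MemLp.coeFn_toLp (hL2 α))] with ξ hξ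
    rw [hξ]
  · exact (((continuous_dsym α).aemeasurable.mul
      (Lp.aestronglyMeasurable _).aemeasurable).enorm.pow_const _)

/-- **All weighted square moments of `𝓕⁻¹g` are finite** when all word derivatives of the smooth
real function `g` are square integrable. [cite: SteinWeiss1971, Ch. I Thm. 2.3 + Thm. 1.8] -/
theorem lintegral_one_add_norm_pow_mul_enorm_sq_fourierInv_lt_top {g : EuclideanSpace ℝ ι → ℝ}
    (hg : ContDiff ℝ ∞ g)
    (hL2 : ∀ {m : ℕ} (β : Fin m → ι), MemLp (fun x => ((ipderiv β g x : ℝ) : ℂ)) 2 volume)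
    {X₀ : Lp ℂ 2 (volume : Measure (EuclideanSpace ℝ ι))}
    (hX₀ : (X₀ : EuclideanSpace ℝ ι → ℂ) =ᵐ[volume] fun x => ((g x : ℝ) : ℂ))
    (k : ℕ) :
    ∫⁻ ξ, ENNReal.ofReal ((1 + ‖ξ‖) ^ (2 * k)) *
        ‖((𝓕⁻ X₀ : Lp ℂ 2 volume) : EuclideanSpace ℝ ι → ℂ) ξ‖ₑ ^ 2 < ⊤ := by
  set F : EuclideanSpace ℝ ι → ℂ := ((𝓕⁻ X₀ : Lp ℂ 2 volume) : EuclideanSpace ℝ ι → ℂ) with hF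
  have hFm : AEMeasurable F volume := (Lp.aestronglyMeasurable _).aemeasurable
  -- order zero
  have h0 : ∫⁻ ξ, ‖F ξ‖ₑ ^ 2 < ⊤ := by
    rw [hF, lintegral_enorm_sq_fourierInv_of_ae_eq hX₀, lintegral_enorm_sq_eq_eLpNorm_sq]
    exact ENNReal.pow_lt_top (hL2 (Fin.elim0 : Fin 0 → ι)).eLpNorm_lt_top
  -- order `k`
  have hk : ∫⁻ ξ, ENNReal.ofReal ((2 * π) ^ (2 * k) * ‖ξ‖ ^ (2 * k)) * ‖F ξ‖ₑ ^ 2 < ⊤ := by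
    rw [hF, lintegral_weight_mul_enorm_sq_fourierInv_eq hg hL2 hX₀ k]
    refine ENNReal.sum_lt_top.2 fun α _ => ?_
    rw [lintegral_enorm_sq_eq_eLpNorm_sq]
    exact ENNReal.pow_lt_top (hL2 α).eLpNorm_lt_top
  -- comparison of the weights
  set C : ℝ := 4 ^ k / (2 * π) ^ (2 * k) with hC
  have hCpos : 0 ≤ C := by positivity
  have hpt : ∀ ξ : EuclideanSpace ℝ ι, ENNReal.ofReal ((1 + ‖ξ‖) ^ (2 * k)) * ‖F ξ‖ₑ ^ 2 ≤
      ENNReal.ofReal (4 ^ k) * ‖F ξ‖ₑ ^ 2 +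
        ENNReal.ofReal C * (ENNReal.ofReal ((2 * π) ^ (2 * k) * ‖ξ‖ ^ (2 * k)) * ‖F ξ‖ₑ ^ 2) := by
    intro ξ
    have h2π : (0 : ℝ) < (2 * π) ^ (2 * k) := by positivity
    have hreal : (1 + ‖ξ‖) ^ (2 * k) ≤ 4 ^ k + C * ((2 * π) ^ (2 * k) * ‖ξ‖ ^ (2 * k)) := by
      have : C * ((2 * π) ^ (2 * k) * ‖ξ‖ ^ (2 * k)) = 4 ^ k * ‖ξ‖ ^ (2 * k) := by
        rw [hC]; field_simp
      rw [this]
      have := one_add_pow_two_mul_le (norm_nonneg ξ) k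
      linarith
    calc ENNReal.ofReal ((1 + ‖ξ‖) ^ (2 * k)) * ‖F ξ‖ₑ ^ 2
        ≤ ENNReal.ofReal (4 ^ k + C * ((2 * π) ^ (2 * k) * ‖ξ‖ ^ (2 * k))) * ‖F ξ‖ₑ ^ 2 := by
          gcongr
      _ = _ := by
          rw [ENNReal.ofReal_add (by positivity) (by positivity), ENNReal.ofReal_mul hCpos, add_mul,
            mul_assoc]
  calc ∫⁻ ξ, ENNReal.ofReal ((1 + ‖ξ‖) ^ (2 * k)) * ‖F ξ‖ₑ ^ 2
      ≤ ∫⁻ ξ, (ENNReal.ofReal (4 ^ k) * ‖F ξ‖ₑ ^ 2 +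
          ENNReal.ofReal C * (ENNReal.ofReal ((2 * π) ^ (2 * k) * ‖ξ‖ ^ (2 * k)) * ‖F ξ‖ₑ ^ 2)) :=
        lintegral_mono hpt
    _ = (ENNReal.ofReal (4 ^ k) * ∫⁻ ξ, ‖F ξ‖ₑ ^ 2) + ENNReal.ofReal C *
          ∫⁻ ξ, ENNReal.ofReal ((2 * π) ^ (2 * k) * ‖ξ‖ ^ (2 * k)) * ‖F ξ‖ₑ ^ 2 := by
        rw [lintegral_add_left' ((hFm.enorm.pow_const _).const_mul _),
          lintegral_const_mul' _ _ ENNReal.ofReal_ne_top,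
          lintegral_const_mul' _ _ ENNReal.ofReal_ne_top]
    _ < ⊤ := ENNReal.add_lt_top.2 ⟨ENNReal.mul_lt_top ENNReal.ofReal_lt_top h0,
        ENNReal.mul_lt_top ENNReal.ofReal_lt_top hk⟩

/-! ### Integrability of the transform (dimension-dependent weights) and pointwise inversion -/

/-- **`(1 + ‖ξ‖)^j 𝓕⁻¹g ∈ L¹(ℝ^ι)` for every `j`** (weighted Cauchy–Schwarz against
`(1 + ‖ξ‖)^{-2(card ι + 1 + j)} ∈ L¹`): in particular the transform of an `H^∞` function is
integrable. [folklore] -/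
theorem integrable_one_add_norm_pow_mul_fourierInv {g : EuclideanSpace ℝ ι → ℝ}
    (hg : ContDiff ℝ ∞ g)
    (hL2 : ∀ {m : ℕ} (β : Fin m → ι), MemLp (fun x => ((ipderiv β g x : ℝ) : ℂ)) 2 volume)
    {X₀ : Lp ℂ 2 (volume : Measure (EuclideanSpace ℝ ι))}
    (hX₀ : (X₀ : EuclideanSpace ℝ ι → ℂ) =ᵐ[volume] fun x => ((g x : ℝ) : ℂ))
    (j : ℕ) :
    Integrable (fun ξ => (((1 + ‖ξ‖) ^ j : ℝ) : ℂ) *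
      ((𝓕⁻ X₀ : Lp ℂ 2 volume) : EuclideanSpace ℝ ι → ℂ) ξ) := by
  set F : EuclideanSpace ℝ ι → ℂ := ((𝓕⁻ X₀ : Lp ℂ 2 volume) : EuclideanSpace ℝ ι → ℂ) with hF
  set k : ℕ := Fintype.card ι + 1 + j with hk_def
  have hFm : AEStronglyMeasurable F volume := Lp.aestronglyMeasurable _
  have hw : Integrable (fun ξ : EuclideanSpace ℝ ι => ((1 + ‖ξ‖) ^ (2 * k))⁻¹) :=
    integrable_inv_one_add_norm_pow (by rw [finrank_euclideanSpace]; omega)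
  have hmom := lintegral_one_add_norm_pow_mul_enorm_sq_fourierInv_lt_top hg hL2 hX₀ (k + j)
  refine ⟨by fun_prop, ?_⟩
  -- pointwise: `(1+‖ξ‖)^j ‖F‖ ≤ w⁻¹ + w (1+‖ξ‖)^{2j} ‖F‖²`, `w = (1+‖ξ‖)^{2k}`
  have hpt : ∀ ξ : EuclideanSpace ℝ ι, ‖(((1 + ‖ξ‖) ^ j : ℝ) : ℂ) * F ξ‖ₑ ≤
      ENNReal.ofReal (((1 + ‖ξ‖) ^ (2 * k))⁻¹) +
        ENNReal.ofReal ((1 + ‖ξ‖) ^ (2 * (k + j))) * ‖F ξ‖ₑ ^ 2 := by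
    intro ξ
    have hwpos : (0 : ℝ) < (1 + ‖ξ‖) ^ (2 * k) := by positivity
    have h1 := le_inv_add_mul_sq hwpos (show (0 : ℝ) ≤ (1 + ‖ξ‖) ^ j * ‖F ξ‖ by positivity)
    have h2 : (1 + ‖ξ‖) ^ (2 * k) * ((1 + ‖ξ‖) ^ j * ‖F ξ‖) ^ 2 =
        (1 + ‖ξ‖) ^ (2 * (k + j)) * ‖F ξ‖ ^ 2 := by ring
    rw [h2] at h1
    rw [← ofReal_norm, norm_mul, Complex.norm_real, Real.norm_of_nonneg (by positivity)]
    refine (ENNReal.ofReal_le_ofReal h1).trans_eq ?_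
    rw [ENNReal.ofReal_add (by positivity) (by positivity), ENNReal.ofReal_mul (by positivity),
      ENNReal.ofReal_pow (norm_nonneg _), ofReal_norm]
  calc ∫⁻ ξ, ‖(((1 + ‖ξ‖) ^ j : ℝ) : ℂ) * F ξ‖ₑ
      ≤ ∫⁻ ξ, (ENNReal.ofReal (((1 + ‖ξ‖) ^ (2 * k))⁻¹) +
          ENNReal.ofReal ((1 + ‖ξ‖) ^ (2 * (k + j))) * ‖F ξ‖ₑ ^ 2) := lintegral_mono hpt
    _ = (∫⁻ ξ, ENNReal.ofReal (((1 + ‖ξ‖) ^ (2 * k))⁻¹)) +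
          ∫⁻ ξ, ENNReal.ofReal ((1 + ‖ξ‖) ^ (2 * (k + j))) * ‖F ξ‖ₑ ^ 2 :=
        lintegral_add_left' (by fun_prop) _
    _ < ⊤ := ENNReal.add_lt_top.2 ⟨hw.lintegral_lt_top, hmom⟩

/-- **`𝓕⁻¹g ∈ L¹(ℝ^ι)`** for smooth `g` with all word derivatives in `L²`. [folklore] -/
theorem integrable_fourierInv {g : EuclideanSpace ℝ ι → ℝ} (hg : ContDiff ℝ ∞ g)
    (hL2 : ∀ {m : ℕ} (β : Fin m → ι), MemLp (fun x => ((ipderiv β g x : ℝ) : ℂ)) 2 volume)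
    {X₀ : Lp ℂ 2 (volume : Measure (EuclideanSpace ℝ ι))}
    (hX₀ : (X₀ : EuclideanSpace ℝ ι → ℂ) =ᵐ[volume] fun x => ((g x : ℝ) : ℂ)) :
    Integrable (((𝓕⁻ X₀ : Lp ℂ 2 volume) : EuclideanSpace ℝ ι → ℂ)) := by
  have h := integrable_one_add_norm_pow_mul_fourierInv hg hL2 hX₀ 0
  simpa using h

/-- **Fourier inversion, pointwise** (Stein–Weiss, Ch. I, Thm. 2.4 for `f̂ ∈ L¹ ∩ L²`): the Fourier
integral of (a representative of) `𝓕⁻¹g` is `g` at every point, both sides being continuous.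
[cite: SteinWeiss1971, Ch. I Thm. 2.3] -/
theorem fourierIntegral_fourierInv_eq {g : EuclideanSpace ℝ ι → ℝ} (hg : ContDiff ℝ ∞ g)
    (hL2 : ∀ {m : ℕ} (β : Fin m → ι), MemLp (fun x => ((ipderiv β g x : ℝ) : ℂ)) 2 volume)
    {X₀ : Lp ℂ 2 (volume : Measure (EuclideanSpace ℝ ι))}
    (hX₀ : (X₀ : EuclideanSpace ℝ ι → ℂ) =ᵐ[volume] fun x => ((g x : ℝ) : ℂ)) :
    𝓕 (((𝓕⁻ X₀ : Lp ℂ 2 volume) : EuclideanSpace ℝ ι → ℂ)) = fun x => ((g x : ℝ) : ℂ) := by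
  set F : EuclideanSpace ℝ ι → ℂ := ((𝓕⁻ X₀ : Lp ℂ 2 volume) : EuclideanSpace ℝ ι → ℂ) with hF
  have hF1 : Integrable F := integrable_fourierInv hg hL2 hX₀
  have hae : 𝓕 F =ᵐ[volume] fun x => ((g x : ℝ) : ℂ) := by
    have h1 := fourier_toLp_ae_eq hF1 (Lp.memLp (𝓕⁻ X₀ : Lp ℂ 2 volume))
    rw [Lp.toLp_coeFn, fourier_fourierInv_eq] at h1
    exact h1.symm.trans hX₀
  exact (Continuous.ae_eq_iff_eq volume (continuous_fourierIntegral hF1)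
    (Complex.continuous_ofReal.comp hg.continuous)).1 hae

/-- **Conjugation symmetry of the transform of a real function**: `𝓕⁻¹g(−ξ) = conj 𝓕⁻¹g(ξ)` for
a.e. `ξ`. [folklore] -/
theorem fourierInv_neg_ae_eq_conj {g : EuclideanSpace ℝ ι → ℝ} (hg : ContDiff ℝ ∞ g)
    (hL2 : ∀ {m : ℕ} (β : Fin m → ι), MemLp (fun x => ((ipderiv β g x : ℝ) : ℂ)) 2 volume)
    {X₀ : Lp ℂ 2 (volume : Measure (EuclideanSpace ℝ ι))}
    (hX₀ : (X₀ : EuclideanSpace ℝ ι → ℂ) =ᵐ[volume] fun x => ((g x : ℝ) : ℂ)) :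
    ∀ᵐ ξ, ((𝓕⁻ X₀ : Lp ℂ 2 volume) : EuclideanSpace ℝ ι → ℂ) (-ξ) =
      conj (((𝓕⁻ X₀ : Lp ℂ 2 volume) : EuclideanSpace ℝ ι → ℂ) ξ) := by
  set F : EuclideanSpace ℝ ι → ℂ := ((𝓕⁻ X₀ : Lp ℂ 2 volume) : EuclideanSpace ℝ ι → ℂ) with hF
  have hF1 : Integrable F := integrable_fourierInv hg hL2 hX₀
  have hF2 : MemLp F 2 volume := Lp.memLp _
  set F' : EuclideanSpace ℝ ι → ℂ := fun ξ => conj (F (-ξ)) with hF'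
  have hF'1 : Integrable F' :=
    (Complex.conjCLE : ℂ →L[ℝ] ℂ).integrable_comp hF1.comp_neg
  have hF'2 : MemLp F' 2 volume :=
    (Complex.conjCLE : ℂ →L[ℝ] ℂ).comp_memLp'
      (hF2.comp_measurePreserving
        (Measure.measurePreserving_neg (volume : Measure (EuclideanSpace ℝ ι))))
  have hFF : 𝓕 F' = 𝓕 F := by
    funext x
    rw [hF', fourierIntegral_conj_neg, hF, fourierIntegral_fourierInv_eq hg hL2 hX₀]
    exact Complex.conj_ofReal _
  filter_upwards [ae_eq_of_fourierIntegral_eq hF'1 hF'2 hF1 hF2 hFF] with ξ hξ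
  rw [← hξ, hF']
  exact (Complex.conj_conj _).symm

/-! ### Components of a smooth `H^∞` vector field -/

/-- All word derivatives of the components of a smooth field with `∫ ‖Dⁿu₀‖² < ∞` are square
integrable (`|∂^β u₀ₗ| ≤ ‖D^m u₀‖`). [folklore] -/
theorem memLp_ipderiv_apply {u₀ : EuclideanSpace ℝ ι → EuclideanSpace ℝ ι} (hsm : ContDiff ℝ ∞ u₀)
    (hH : ∀ n : ℕ, ∫⁻ x, ‖iteratedFDeriv ℝ n u₀ x‖ₑ ^ 2 < ⊤) (l : ι) {m : ℕ} (β : Fin m → ι) :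
    MemLp (fun x => ((ipderiv β (fun y => u₀ y l) x : ℝ) : ℂ)) 2 volume := by
  have hg : ContDiff ℝ ∞ fun y => u₀ y l := contDiff_euclidean.1 hsm l
  refine memLp_two_of_lintegral_sq_lt_top ?_ (lt_of_le_of_lt (lintegral_mono fun x => ?_) (hH m))
  · exact (Complex.continuous_ofReal.comp (contDiff_ipderiv hg β).continuous).aestronglyMeasurable
  · rw [enorm_ofReal_sq, ← ofReal_norm, ← ENNReal.ofReal_pow (norm_nonneg _), ← sq_abs]
    exact ENNReal.ofReal_le_ofReal (pow_le_pow_left₀ (abs_nonneg _)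
      ((abs_ipderiv_le_norm_iteratedFDeriv hg β x).trans
        (norm_iteratedFDeriv_apply_le hsm l m x)) 2)

omit [DecidableEq ι] in
/-- `‖v‖² = ∑ₗ |vₗ|²` in `ℝ≥0∞`, components complexified. [folklore] -/
theorem enorm_sq_eq_sum_enorm_ofReal_sq (v : EuclideanSpace ℝ ι) :
    ‖v‖ₑ ^ 2 = ∑ l, ‖((v l : ℝ) : ℂ)‖ₑ ^ 2 := by
  simp_rw [enorm_ofReal_sq]
  rw [← ofReal_norm, ← ENNReal.ofReal_pow (norm_nonneg _), EuclideanSpace.real_norm_sq_eq,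
    ENNReal.ofReal_sum_of_nonneg fun l _ => sq_nonneg _]

/-- `|∇u₀(x)|²_F = ∑ᵢ ∑_{|α| = 1} (∂^α u₀ᵢ(x))²` in `ℝ≥0∞`, for `u₀` differentiable at `x`
(`levelSq_one_eq_frobeniusNormSq`). [folklore] -/
theorem ofReal_frobeniusNormSq_fderiv_eq_sum {u₀ : EuclideanSpace ℝ ι → EuclideanSpace ℝ ι}
    {x : EuclideanSpace ℝ ι} (hu : DifferentiableAt ℝ u₀ x) :
    ENNReal.ofReal (frobeniusNormSq (fderiv ℝ u₀ x)) =
      ∑ i, ∑ α : Fin 1 → ι, ‖((ipderiv α (fun y => u₀ y i) x : ℝ) : ℂ)‖ₑ ^ 2 := by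
  rw [← levelSq_one_eq_frobeniusNormSq hu, levelSq,
    ENNReal.ofReal_sum_of_nonneg fun i _ => dnormSq_nonneg _ _ _]
  refine Finset.sum_congr rfl fun i _ => ?_
  rw [dnormSq, ENNReal.ofReal_sum_of_nonneg fun α _ => sq_nonneg _]
  exact Finset.sum_congr rfl fun α _ => (enorm_ofReal_sq _).symm

/-! ### The Fourier datum of a smooth divergence-free `H^∞` field -/

/-- **Plancherel for smooth `H^∞` divergence-free fields (general dimension).** Every smooth
divergence-free `u₀ : ℝ^ι → ℝ^ι` with `∫ ‖Dⁿu₀‖² < ∞` for all `n` is `synthVel a = Re 𝓕 a` for a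
Fourier datum `a` of Sobolev class (`IsSobolevFourierDatum a`), with
`∫ (1 + 4π²‖ξ‖²) ∑ₗ |aₗ|² = ‖u₀‖²_{L²} + ‖∇u₀‖²_{L²}`. The datum is a representative of the `L²`
inverse transform `𝓕⁻¹u₀` (componentwise), corrected on a null set so that the divergence
relation `∑ₗ ξₗ aₗ = 0` and the conjugation symmetry hold at every frequency.
[cite: SteinWeiss1971, Ch. I Thm. 2.3 + Thm. 1.8] -/
theorem exists_isSobolevFourierDatum {u₀ : EuclideanSpace ℝ ι → EuclideanSpace ℝ ι}
    (hsm : ContDiff ℝ ∞ u₀)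
    (hdiv : VectorCalculus.IsDivFree u₀) (hH : ∀ n : ℕ, ∫⁻ x, ‖iteratedFDeriv ℝ n u₀ x‖ₑ ^ 2 < ⊤) :
    ∃ a : EuclideanSpace ℝ ι → ι → ℂ, IsSobolevFourierDatum a ∧ synthVel a = u₀ ∧
      (∫⁻ ξ, ENNReal.ofReal (1 + 4 * π ^ 2 * ‖ξ‖ ^ 2) * ∑ l, ‖a ξ l‖ₑ ^ 2) =
        (∫⁻ x, ‖u₀ x‖ₑ ^ 2) + ∫⁻ x, ENNReal.ofReal (frobeniusNormSq (fderiv ℝ u₀ x)) := by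
  -- the components, their `L²` classes and their inverse transforms
  set g : ι → (EuclideanSpace ℝ ι) → ℝ := fun l y => u₀ y l with hg_def
  have hg : ∀ l, ContDiff ℝ ∞ (g l) := fun l => contDiff_euclidean.1 hsm l
  have hL2 : ∀ l {m : ℕ} (β : Fin m → ι), MemLp (fun x => ((ipderiv β (g l) x : ℝ) : ℂ)) 2 volume :=
    fun l m β => memLp_ipderiv_apply hsm hH l β
  set X₀ : ι → Lp ℂ 2 (volume : Measure (EuclideanSpace ℝ ι)) :=
    fun l => (hL2 l (Fin.elim0 : Fin 0 → ι)).toLp _ with hX₀_def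
  have hX₀ : ∀ l, (X₀ l : EuclideanSpace ℝ ι → ℂ) =ᵐ[volume] fun x => ((g l x : ℝ) : ℂ) :=
    fun l => MemLp.coeFn_toLp _
  set F : ι → EuclideanSpace ℝ ι → ℂ :=
    fun l => ((𝓕⁻ (X₀ l) : Lp ℂ 2 volume) : EuclideanSpace ℝ ι → ℂ) with hF_def
  have hFm : ∀ l, Measurable (F l) := fun l => (Lp.stronglyMeasurable _).measurable
  -- conjugation symmetry a.e.
  have hconj : ∀ᵐ ξ, ∀ l, F l (-ξ) = conj (F l ξ) :=
    ae_all_iff.2 fun l => fourierInv_neg_ae_eq_conj (hg l) (hL2 l) (hX₀ l)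
  -- the divergence relation a.e.
  have hdivae : ∀ᵐ ξ, ∑ l, ((ξ l : ℝ) : ℂ) * F l ξ = 0 := by
    set T : ι → Lp ℂ 2 (volume : Measure (EuclideanSpace ℝ ι)) :=
      fun l => (hL2 l (fun _ : Fin 1 => l)).toLp _ with hT_def
    have hw : ∀ l, ((𝓕⁻ (T l) : Lp ℂ 2 volume) : EuclideanSpace ℝ ι → ℂ) =ᵐ[volume]
        fun ξ => (-(2 * π * I) * ((ξ l : ℝ) : ℂ)) * F l ξ := fun l => by
      filter_upwards [fourierInv_ipderiv_ae_eq (hg l) (hL2 l) (hX₀ l) (fun _ : Fin 1 => l)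
        (MemLp.coeFn_toLp (hL2 l _))] with ξ hξ
      rw [hξ, dsym_succ, dsym_zero, mul_one]
    have hsum0 : (∑ l, T l) = 0 := by
      refine Lp.ext ((Lp.coeFn_fun_finsetSum _ _).trans
        (Filter.EventuallyEq.trans ?_ (Lp.coeFn_zero ℂ 2 volume).symm))
      have hall : ∀ᵐ x, ∀ l, (T l : EuclideanSpace ℝ ι → ℂ) x =
          ((ipderiv (fun _ : Fin 1 => l) (g l) x : ℝ) : ℂ) :=
        ae_all_iff.2 fun l => MemLp.coeFn_toLp (hL2 l _)
      filter_upwards [hall] with x hx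
      simp only [hx]
      change (∑ l, ((pderiv l (g l) x : ℝ) : ℂ)) = (0 : EuclideanSpace ℝ ι → ℂ) x
      rw [← Complex.ofReal_sum, hdiv.sum_pderiv_comp_eq_zero (hsm.differentiable (by simp)) x]
      simp
    have hF0 : ((𝓕⁻ (∑ l, T l) : Lp ℂ 2 volume) : EuclideanSpace ℝ ι → ℂ) =ᵐ[volume] 0 := by
      rw [hsum0, ← fourierInvCLM_apply (R := ℂ), map_zero]
      exact Lp.coeFn_zero ℂ 2 volume
    have hFsum : ((𝓕⁻ (∑ l, T l) : Lp ℂ 2 volume) : EuclideanSpace ℝ ι → ℂ) =ᵐ[volume]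
        fun ξ => ∑ l, ((𝓕⁻ (T l) : Lp ℂ 2 volume) : EuclideanSpace ℝ ι → ℂ) ξ := by
      rw [← fourierInvCLM_apply (R := ℂ), map_sum]
      simpa only [fourierInvCLM_apply] using Lp.coeFn_fun_finsetSum Finset.univ
        (fun l => (𝓕⁻ (T l) : Lp ℂ 2 volume))
    have hall := ae_all_iff.2 hw
    filter_upwards [hF0, hFsum, hall] with ξ h0 hs hwξ
    have h : -(2 * π * I) * ∑ l, ((ξ l : ℝ) : ℂ) * F l ξ = 0 := by
      rw [Finset.mul_sum]
      have h' := hs.symm.trans h0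
      simp only [Pi.zero_apply] at h'
      rw [← h']
      exact Finset.sum_congr rfl fun l _ => by rw [hwξ l]; ring
    rcases mul_eq_zero.1 h with h | h
    · exfalso
      have : (2 * π * Complex.I) ≠ 0 := by simp [Real.pi_ne_zero]
      exact this (neg_eq_zero.1 h)
    · exact h
  -- the good set of full measure, symmetric under `ξ ↦ -ξ`
  set S₁ : Set (EuclideanSpace ℝ ι) :=
    (⋂ l, {ξ | F l (-ξ) = conj (F l ξ)}) ∩ {ξ | ∑ l, ((ξ l : ℝ) : ℂ) * F l ξ = 0} with hS₁_def
  have hS₁m : MeasurableSet S₁ := by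
    refine (MeasurableSet.iInter fun l => measurableSet_eq_fun ((hFm l).comp measurable_neg)
      (Complex.continuous_conj.measurable.comp (hFm l))).inter
      (measurableSet_eq_fun (Finset.measurable_sum _ fun l _ => ?_) measurable_const)
    exact ((by fun_prop : Continuous fun ξ : EuclideanSpace ℝ ι => ((ξ l : ℝ) : ℂ)).measurable).mul
      (hFm l)
  have hS₁ae : ∀ᵐ ξ, ξ ∈ S₁ := by
    filter_upwards [hconj, hdivae] with ξ h1 h2
    exact ⟨Set.mem_iInter.2 h1, h2⟩
  set S : Set (EuclideanSpace ℝ ι) := S₁ ∩ Neg.neg ⁻¹' S₁ with hS_def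
  have hSm : MeasurableSet S := hS₁m.inter (measurable_neg hS₁m)
  have hSae : ∀ᵐ ξ, ξ ∈ S := by
    have hneg : ∀ᵐ ξ, -ξ ∈ S₁ :=
      (Measure.measurePreserving_neg
        (volume : Measure (EuclideanSpace ℝ ι))).quasiMeasurePreserving.tendsto_ae.eventually hS₁ae
    filter_upwards [hS₁ae, hneg] with ξ h1 h2
    exact ⟨h1, h2⟩
  have hSsymm : ∀ ξ, ξ ∈ S → -ξ ∈ S := fun ξ h => ⟨h.2, by simpa [hS_def] using h.1⟩
  have hS₁conj : ∀ ξ, ξ ∈ S₁ → ∀ l, F l (-ξ) = conj (F l ξ) := fun ξ h l => Set.mem_iInter.1 h.1 l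
  -- the datum
  set a : EuclideanSpace ℝ ι → ι → ℂ := S.indicator fun ξ l => F l ξ with ha_def
  have haF : ∀ᵐ ξ, a ξ = fun l => F l ξ := by
    filter_upwards [hSae] with ξ hξ
    rw [ha_def, Set.indicator_of_mem hξ]
  have haFl : ∀ l, (fun ξ => a ξ l) =ᵐ[volume] F l := fun l => by
    filter_upwards [haF] with ξ hξ
    rw [hξ]
  refine ⟨a, ⟨?_, ?_, ?_, ?_⟩, ?_, ?_⟩
  · -- measurability
    exact ((measurable_pi_lambda _ fun l => hFm l).indicator hSm).aestronglyMeasurable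
  · -- weighted square moments
    intro k
    calc ∫⁻ ξ, ENNReal.ofReal ((1 + ‖ξ‖) ^ (2 * k)) * ∑ l, ‖a ξ l‖ₑ ^ 2
        = ∫⁻ ξ, ∑ l, ENNReal.ofReal ((1 + ‖ξ‖) ^ (2 * k)) * ‖F l ξ‖ₑ ^ 2 := by
          refine lintegral_congr_ae ?_
          filter_upwards [haF] with ξ hξ
          rw [hξ, Finset.mul_sum]
      _ = ∑ l, ∫⁻ ξ, ENNReal.ofReal ((1 + ‖ξ‖) ^ (2 * k)) * ‖F l ξ‖ₑ ^ 2 :=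
          lintegral_finsetSum' _ fun l _ => ((ENNReal.measurable_ofReal.comp (by fun_prop)).mul
            ((hFm l).enorm.pow_const _)).aemeasurable
      _ < ⊤ := ENNReal.sum_lt_top.2 fun l _ =>
          lintegral_one_add_norm_pow_mul_enorm_sq_fourierInv_lt_top (hg l) (hL2 l) (hX₀ l) k
  · -- divergence relation, everywhere
    intro ξ
    by_cases hξ : ξ ∈ S
    · rw [ha_def, Set.indicator_of_mem hξ]
      exact hξ.1.2
    · rw [ha_def, Set.indicator_of_notMem hξ]
      simp
  · -- conjugation symmetry, everywhere
    intro ξ l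
    by_cases hξ : ξ ∈ S
    · rw [ha_def, Set.indicator_of_mem hξ, Set.indicator_of_mem (hSsymm ξ hξ)]
      exact hS₁conj ξ hξ.1 l
    · have hξ' : -ξ ∉ S := fun h => hξ (by simpa using hSsymm (-ξ) h)
      rw [ha_def, Set.indicator_of_notMem hξ, Set.indicator_of_notMem hξ']
      simp
  · -- the synthesis is `u₀`
    funext x
    ext l
    rw [synthVel_apply, Real.fourier_congr_ae (haFl l) x,
      congrFun (fourierIntegral_fourierInv_eq (hg l) (hL2 l) (hX₀ l)) x, Complex.ofReal_re]
  · -- the `H¹` identity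
    have h4π : ∀ ξ : EuclideanSpace ℝ ι, ENNReal.ofReal (1 + 4 * π ^ 2 * ‖ξ‖ ^ 2) =
        1 + ENNReal.ofReal ((2 * π) ^ (2 * 1) * ‖ξ‖ ^ (2 * 1)) := fun ξ => by
      rw [ENNReal.ofReal_add zero_le_one (by positivity), ENNReal.ofReal_one]
      congr 2
      ring
    calc ∫⁻ ξ, ENNReal.ofReal (1 + 4 * π ^ 2 * ‖ξ‖ ^ 2) * ∑ l, ‖a ξ l‖ₑ ^ 2
        = ∫⁻ ξ, ∑ l, (‖F l ξ‖ₑ ^ 2 +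
            ENNReal.ofReal ((2 * π) ^ (2 * 1) * ‖ξ‖ ^ (2 * 1)) * ‖F l ξ‖ₑ ^ 2) := by
          refine lintegral_congr_ae ?_
          filter_upwards [haF] with ξ hξ
          rw [hξ, h4π, Finset.mul_sum]
          exact Finset.sum_congr rfl fun l _ => by rw [add_mul, one_mul]
      _ = ∑ l, ((∫⁻ ξ, ‖F l ξ‖ₑ ^ 2) +
            ∫⁻ ξ, ENNReal.ofReal ((2 * π) ^ (2 * 1) * ‖ξ‖ ^ (2 * 1)) * ‖F l ξ‖ₑ ^ 2) := by
          rw [lintegral_finsetSum' _ fun l _ => ?_]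
          · exact Finset.sum_congr rfl fun l _ =>
              lintegral_add_left ((hFm l).enorm.pow_const _) _
          · exact (((hFm l).enorm.pow_const _).add ((ENNReal.measurable_ofReal.comp
              (by fun_prop)).mul ((hFm l).enorm.pow_const _))).aemeasurable
      _ = ∑ l, ((∫⁻ x, ‖((g l x : ℝ) : ℂ)‖ₑ ^ 2) +
            ∑ α : Fin 1 → ι, ∫⁻ x, ‖((ipderiv α (g l) x : ℝ) : ℂ)‖ₑ ^ 2) := by
          refine Finset.sum_congr rfl fun l _ => ?_
          rw [hF_def, lintegral_enorm_sq_fourierInv_of_ae_eq (hX₀ l),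
            lintegral_weight_mul_enorm_sq_fourierInv_eq (hg l) (hL2 l) (hX₀ l) 1]
      _ = (∑ l, ∫⁻ x, ‖((g l x : ℝ) : ℂ)‖ₑ ^ 2) +
            ∑ l, ∑ α : Fin 1 → ι, ∫⁻ x, ‖((ipderiv α (g l) x : ℝ) : ℂ)‖ₑ ^ 2 :=
          Finset.sum_add_distrib
      _ = (∫⁻ x, ‖u₀ x‖ₑ ^ 2) + ∫⁻ x, ENNReal.ofReal (frobeniusNormSq (fderiv ℝ u₀ x)) := by
          congr 1
          · rw [← lintegral_finsetSum _ fun l _ => ?_]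
            · exact lintegral_congr fun x => (enorm_sq_eq_sum_enorm_ofReal_sq (u₀ x)).symm
            · exact (Complex.continuous_ofReal.comp (hg l).continuous).measurable.enorm.pow_const _
          · have hmeas : ∀ l (α : Fin 1 → ι),
                Measurable fun x => ‖((ipderiv α (g l) x : ℝ) : ℂ)‖ₑ ^ 2 := fun l α =>
              (Complex.continuous_ofReal.comp
                (contDiff_ipderiv (hg l) α).continuous).measurable.enorm.pow_const _
            rw [← Finset.sum_congr rfl fun l _ => lintegral_finsetSum _ fun α _ => hmeas l α,
              ← lintegral_finsetSum _ fun l _ => Finset.measurable_sum _ fun α _ => hmeas l α]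
            exact lintegral_congr fun x =>
              (ofReal_frobeniusNormSq_fderiv_eq_sum ((hsm.differentiable (by simp)) x)).symm

end Euclidean

end FourierNS

open FourierNS in
/-- **Discharge of `sobolev_fourierDatum_of_smooth` (Plancherel for smooth `H^∞` divergence-free
fields on `ℝ³`).** Every smooth divergence-free `u₀ : ℝ³ → ℝ³` with `∫ ‖Dⁿu₀‖² < ∞` for every `n`
is `synthVel a = Re 𝓕 a` for a Fourier datum `a` of Sobolev class, with
`fourierH1Sq a = ‖u₀‖²_{L²} + ‖∇u₀‖²_{L²}`: the case `ι = Fin 3` of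
`FourierNS.exists_isSobolevFourierDatum` (Stein–Weiss 1971, Ch. I, Thm. 2.3 (Plancherel) with
Thm. 1.8 / (1.9)(ii) (transform of a derivative), on `L²` via tempered distributions).
[cite: SteinWeiss1971, Ch. I Thm. 2.3 + Thm. 1.8] -/
theorem sobolev_fourierDatum_of_smooth_holds : sobolev_fourierDatum_of_smooth :=
  fun _u₀ hsm hdiv hH => exists_isSobolevFourierDatum hsm hdiv hH

end Literature.Analysis.FluidPDE

end
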